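import Summits.CriticalPhenomena.PercolationContinuityZ3.Theorems.PercNearOneGluingNoHeavyQuantGatedSliceMixLawCells
import Summits.CriticalPhenomena.PercolationContinuityZ3.Theorems.PercNearOneGluingNoHeavyQuantGatedSliceMixLawExchange
import Summits.CriticalPhenomena.PercolationContinuityZ3.Theorems.PercNearOneGluingNoHeavyQuantIncomeCriterion
import HarnessLib

/-!
# QUANT lane R8, T-DEC, leg (III), blob case — `LawDec.GatedSliceMixLaw'`, the Q-alone cell Q4′ PROVED: the twin `k₁ + a` of the low `k₁`
# is a mid above the target able to absorb the whole low; the zero rides the twin's leftover and the giants (offer form of the income criterion)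

builds on p205010 (kernel theorem, internal audit signed; external expert review pending)

Support file (`--supports stmt-CriticalPhenomena-4575`), QUANT lane typer seat prim-quant-stmt (gen 30), rung R8 of
`run/shared/lean/prim/quant/LADDER.md`.  Memo `run/shared/lean/prim/quant/prim-quant-stmt-g30/MIXLAW-MIXTURES-G30.md` §6.  One theorem,
standard axioms, no sorries.  Statement: `…QuantGatedSliceMixLawCells` (`MixLawCellQ4p`); tools: `flowAtT_pair` (`…Exchange`),
`flowAtT_of_offers` (arm-1 g39, `…QuantIncomeCriterion`).

THE CELL (`k₁` a `t`-low, `ℓ = k₁ + a ≤ j` with `t < ℓ`, `k₂ ≥ j+1`, `m₁·usage(k₁,ℓ) ≤ m₁'`).  Flow: the whole low `k₁` into its twin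
(`flowAtT_pair`, load `m₁·usage ≤ m₁'`); the rest of the law — the zero `z`, the twin's leftover `m₁' − m₁·usage`, the giants `k₂`, `k₂ + a` —
has the zero as its only low, and the zero's offer inequality `t·z ≤ (ℓ − t)(m₁' − m₁·usage) + (t(1−y)/y)(m₂ + m₂')` follows from the mean
identity `t·z = (ℓ−t)m₁' − (t−k₁)m₁ + (k₂−t)m₂ + (k₂+a−t)m₂'`, `usage(k₁,ℓ)(ℓ − t) ≤ t − k₁` (`usage_mid_mul_le`) and `y(k₂+a) ≤ t`.
Exact census of the seat (explore/qroutes2.py "twin only"): 2 751 / 0.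

* **`LawDec.mixLawCellQ4p_holds : MixLawCellQ4p`**.

[this work]; income criterion: arm-1 g39.  The gluing rows served [cite: KozmaNitzan2024, Conjecture 3 (p. 15)]; product measure
[cite: Grimmett1999, §1.3 p. 10].
-/

noncomputable section

namespace Summit.CriticalPhenomena.PercolationContinuityZ3.Theorems

namespace Quant

open Finset

/-- the two-point law `{lo, hi; g}` (as in `…QuantLawDEC`) -/
local notation3 "TP[" lo ", " hi ", " g ", " h "]" =>
  (g : ℝ) * (if (h : ℕ) = (hi : ℕ) then (1 : ℝ) else 0) + (1 - (g : ℝ)) * (if (h : ℕ) = (lo : ℕ) then (1 : ℝ) else 0)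

namespace LawDec

set_option maxHeartbeats 800000 in
/-- **CELL Q4′ HOLDS**: see the file header. [this work] -/
theorem mixLawCellQ4p_holds : MixLawCellQ4p := by
  intro y z g S lam a j M k₁ k₂ hy0 hy1 hz0 hz1 hg1 hyg ha hjM hS0 hta hSj hSM hk hk₂M hlam0 hlam1 hmean hk₁j hk₁low hlj hlt hk₂G hsat
  classical
  set t : ℝ := S + (a : ℝ) * g * (1 - z) with ht
  have h1z : 0 < 1 - z := by linarith
  have hg0 : 0 < g := by nlinarith
  have h1y : 0 < 1 - y := by linarith
  have ha0 : (0 : ℝ) ≤ a := Nat.cast_nonneg a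
  have hk₁0 : (0 : ℝ) ≤ k₁ := Nat.cast_nonneg k₁
  have h1lam : 0 ≤ 1 - lam := by linarith
  have ht0 : 0 < t := by linarith
  have hyk₂ : y * (k₂ : ℝ) ≤ S := le_trans (mul_le_mul_of_nonneg_left (by exact_mod_cast hk₂M) hy0.le) hta
  have htaN : ∀ p : ℕ, p ≤ M + a → y * (p : ℝ) ≤ t := by
    intro p hp
    have : (p : ℝ) ≤ ((M + a : ℕ) : ℝ) := by exact_mod_cast hp
    push_cast at this; rw [ht]; nlinarith [mul_nonneg ha0 hg0.le]
  set m₁ : ℝ := (1 - z) * (1 - lam) * (1 - g) with hm₁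
  set m₁' : ℝ := (1 - z) * (1 - lam) * g with hm₁'
  set m₂ : ℝ := (1 - z) * lam * (1 - g) with hm₂
  set m₂' : ℝ := (1 - z) * lam * g with hm₂'
  have hm₁0 : 0 ≤ m₁ := mul_nonneg (mul_nonneg h1z.le h1lam) (by linarith)
  have hm₁'0 : 0 ≤ m₁' := mul_nonneg (mul_nonneg h1z.le h1lam) hg0.le
  have hm₂0 : 0 ≤ m₂ := mul_nonneg (mul_nonneg h1z.le hlam0) (by linarith)
  have hm₂'0 : 0 ≤ m₂' := mul_nonneg (mul_nonneg h1z.le hlam0) hg0.le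
  -- the twin pair
  set Ut : ℝ := usage y t j k₁ (k₁ + a) with hUt
  have hcompt : t < (k₁ : ℝ) + ((k₁ + a : ℕ) : ℝ) := by linarith
  have hk₁lt : k₁ < k₁ + a := by
    have : (k₁ : ℝ) < ((k₁ + a : ℕ) : ℝ) := by linarith
    exact_mod_cast this
  have hUtpos : 0 < Ut := usage_pos_of_compat y t j k₁ (k₁ + a) hy0 hy1 hk₁low hk₁lt (Or.inr hcompt)
  have hlmid : t ≤ 2 * ((k₁ + a : ℕ) : ℝ) := by
    have : (0 : ℝ) ≤ ((k₁ + a : ℕ) : ℝ) := Nat.cast_nonneg _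
    linarith
  have hsat' : Ut * m₁ ≤ m₁' := by rw [hUt, mul_comm]; exact hsat
  have Ptwin := flowAtT_pair y t j (M + a) k₁ (k₁ + a) m₁ (Ut * m₁) hk₁j hk₁low (by omega) (Or.inr hlmid) (Or.inr hcompt)
    hm₁0 (le_of_eq (by rw [hUt]))
  -- the rest: zero + twin leftover + giants, by the offer form of the income criterion with no routed low
  set c : ℝ := m₁' - Ut * m₁ with hc
  have hc0 : 0 ≤ c := by rw [hc]; linarith
  set R : ℕ → ℝ := fun p => z * (if p = 0 then (1 : ℝ) else 0) + c * (if p = k₁ + a then (1 : ℝ) else 0)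
    + m₂ * (if p = k₂ then (1 : ℝ) else 0) + m₂' * (if p = k₂ + a then (1 : ℝ) else 0) with hR
  have hR0 : ∀ p, 0 ≤ R p := fun p => by
    simp only [hR]
    refine add_nonneg (add_nonneg (add_nonneg (mul_nonneg hz0 ?_) (mul_nonneg hc0 ?_)) (mul_nonneg hm₂0 ?_)) (mul_nonneg hm₂'0 ?_) <;>
      split_ifs <;> norm_num
  -- the offer inequality
  have hsave : Ut * m₁ * (((k₁ + a : ℕ) : ℝ) - t) ≤ m₁ * (t - k₁) := by
    have hU := usage_mid_mul_le y t j k₁ (k₁ + a) hy0 hy1 hk₁low hlj hcompt (htaN (k₁ + a) (by omega))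
    rw [← hUt] at hU
    calc Ut * m₁ * (((k₁ + a : ℕ) : ℝ) - t) = m₁ * (Ut * (((k₁ + a : ℕ) : ℝ) - t)) := by ring
      _ ≤ m₁ * (t - k₁) := mul_le_mul_of_nonneg_left hU hm₁0
  have hmeanid : t * z = (((k₁ + a : ℕ) : ℝ) - t) * m₁' - (t - k₁) * m₁ + ((k₂ : ℝ) - t) * m₂ + (((k₂ + a : ℕ) : ℝ) - t) * m₂' := by
    simp only [hm₁, hm₁', hm₂, hm₂']; push_cast; rw [ht]
    have hS' : S = (1 - z) * ((k₁ : ℝ) + ((k₂ : ℝ) - k₁) * lam) := hmean.symm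
    rw [hS']; ring
  have hoff : t * z ≤ (((k₁ + a : ℕ) : ℝ) - t) * c + t * (1 - y) / y * m₂ + t * (1 - y) / y * m₂' := by
    have hg1' : ((k₂ : ℝ) - t) * m₂ ≤ t * (1 - y) / y * m₂ := by
      refine mul_le_mul_of_nonneg_right ?_ hm₂0
      rw [le_div_iff₀ hy0]
      have := htaN k₂ (by omega)
      nlinarith
    have hg2' : (((k₂ + a : ℕ) : ℝ) - t) * m₂' ≤ t * (1 - y) / y * m₂' := by
      refine mul_le_mul_of_nonneg_right ?_ hm₂'0
      rw [le_div_iff₀ hy0]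
      have := htaN (k₂ + a) (by omega)
      nlinarith
    have e : (((k₁ + a : ℕ) : ℝ) - t) * c = (((k₁ + a : ℕ) : ℝ) - t) * m₁' - Ut * m₁ * (((k₁ + a : ℕ) : ℝ) - t) := by
      rw [hc]; ring
    rw [hmeanid, e]
    linarith [hsave, hg1', hg2']
  have Prest : FlowAtT y t j (M + a) R := by
    refine flowAtT_of_offers y t j (M + a) R (fun _ _ => 0) hy0 hy1 ht0 hR0
      (fun p hpj hpM _ => htaN p hpM) (fun _ _ => le_rfl) (fun l h hp => absurd hp (lt_irrefl 0)) ?_ ?_ ?_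
    · -- no nonzero low carries mass in R
      intro l hl1 hlj hlow
      rw [Finset.sum_const_zero]
      simp only [hR]
      rw [if_neg (by omega), if_neg (show l ≠ k₁ + a by intro h; subst h; linarith), if_neg (show l ≠ k₂ by omega),
        if_neg (show l ≠ k₂ + a by omega)]
      ring
    · intro h _ _
      simp only [mul_zero, Finset.sum_const_zero]
      exact hR0 h
    · -- the offer inequality, evaluated
      have e : ∀ h ∈ Finset.range (M + a + 1),
          (if j + 1 ≤ h then t * (1 - y) / y else if t < (h : ℝ) then (h : ℝ) - t else 0)
            * (R h - ∑ l ∈ Finset.range (j + 1), usage y t j l h * (0 : ℝ))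
          = (((k₁ + a : ℕ) : ℝ) - t) * c * (if h = k₁ + a then (1 : ℝ) else 0)
            + t * (1 - y) / y * m₂ * (if h = k₂ then (1 : ℝ) else 0) + t * (1 - y) / y * m₂' * (if h = k₂ + a then (1 : ℝ) else 0) := by
        intro h _
        simp only [mul_zero, Finset.sum_const_zero, sub_zero, hR]
        by_cases h0 : h = 0
        · subst h0
          rw [if_neg (by omega), if_neg (by push_cast; linarith), if_pos rfl, if_neg (by omega), if_neg (by omega), if_neg (by omega)]
          ring
        rw [if_neg h0]
        by_cases hl : h = k₁ + a
        · subst hl; rw [if_neg (by omega), if_pos (by exact_mod_cast hlt), if_pos rfl, if_neg (by omega), if_neg (by omega)]; ring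
        rw [if_neg hl]
        by_cases h2 : h = k₂
        · subst h2; rw [if_pos hk₂G, if_pos rfl, if_neg (by omega)]; ring
        rw [if_neg h2]
        by_cases h3 : h = k₂ + a
        · subst h3; rw [if_pos (by omega), if_pos rfl]; ring
        rw [if_neg h3]; ring
      rw [Finset.sum_congr rfl e, Finset.sum_add_distrib, Finset.sum_add_distrib,
        sum_mul_indicator (fun _ => (((k₁ + a : ℕ) : ℝ) - t) * c) (M + a) (k₁ + a) (by omega),
        sum_mul_indicator (fun _ => t * (1 - y) / y * m₂) (M + a) k₂ (by omega),
        sum_mul_indicator (fun _ => t * (1 - y) / y * m₂') (M + a) (k₂ + a) (by omega)]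
      have hR0' : R 0 = z := by
        simp only [hR]
        rw [if_neg (show (0 : ℕ) ≠ k₁ + a by omega), if_neg (show (0 : ℕ) ≠ k₂ by omega), if_neg (show (0 : ℕ) ≠ k₂ + a by omega)]
        simp
      rw [hR0']
      linarith [hoff]
  -- assemble P = twin pair + rest
  have hsum := FlowAtT.add Ptwin Prest
  have hflow : FlowAtT y t j (M + a)
      (fun p => z * (if p = 0 then (1 : ℝ) else 0) + (1 - z) * slice (fun q => TP[k₁, k₂, lam, q]) a g p) := by
    refine (congrArg (FlowAtT y t j (M + a)) (funext fun p => ?_)).mp hsum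
    rw [movedTwoPoint_apply, ← hm₁, ← hm₁', ← hm₂, ← hm₂']
    simp only [hR, hc]
    ring
  exact decAtT_of_flowAtT y t j (M + a) _ hy0 hy1 (fun p hp => movedTwoPoint_eq_zero z lam g a k₁ k₂ p hk (by omega))
    (sum_movedTwoPoint z lam g a k₁ k₂ (M + a) hk (by omega)) hflow

end LawDec

end Quant

end Summit.CriticalPhenomena.PercolationContinuityZ3.Theorems
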